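import Summits.CriticalPhenomena.SAWScalingLimit.Theses.SAWTotalPositivity

/-!
# Line `radial-portal-transfer` — skeleton for crux `TPToTraversalBound` (stmt-CriticalPhenomena-10687)

Crux (route `SAWTotalPositivity`, rank 3):
`TPToTraversalBound := BoundaryTP2 → CriticalBubbleBound → SAWTraversalBound` (`Iff.rfl`,
Disproof §1), i.e. circular TP₂ of the critical SAW boundary kernel + the finite bubble should give
the Aizenman–Burchard hypothesis (H1) for the chordal critical square-lattice SAW.  By Disproof F1/F4
(`not_crux_iff`; the `Z ≡ 1` Peano toy) every line must prove (H1) itself from a SAW-specific seed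
and may use TP₂ + B only as mesh-scale hygiene; this skeleton does exactly that.

Idea (card `Ideas/radial-portal-transfer.md`, triage r1-1/2/3: pass ×3): pin the walk at BOTH ends
of every visit to a nested family of clean lattice squares `B_l = B_∞(c, N_l δ)`, `N_l = 4^{-l} N_0`.
Conditioning on the OUTSIDE CONFIGURATION of `B_l` (the set of lattice edges of `γ` with both ends
outside the open box — `outEdgeSet`; its atoms generate an increasing filtration `F_l`) is the exact
two-sided domain Markov property: given `F_l` the inside of the clean box is a multi-strand critical
SAW system with combinatorial portal data, whatever the (fractal) outside.  The state variable of
the resulting chain over scales is the HEAVINESS `h_l` = number of maximal pieces of `γ` outside the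
open box `B_l` of sup-diameter `≥ N_l/2` (`HasPieces γ c N N m`; big portal-to-portal excursions,
forced loose strands included), an `F_l`-measurable count.  The line's two analytic inputs:

* CONTRACTION (`HeavinessContraction`, sup over outside data, boxes of ratio 4): given `F_l` with
  `h_l ≤ m`, `P(h_{l+1} ≥ j | F_l) ≤ C·2^{-λ₀ j}` for all `j ≥ θ m + m₀`, one `θ < 1` — heavy
  data force at most a `θ`-fraction of their big strands one ratio-4 scale further in, everything
  beyond is paid exponentially; split (triage r1-2/r1-3) into the CLEAN kernel statement
  `CleanContraction` (outside data with `≤ m` pieces in total = undecorated `(m+1)`-strand states of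
  the clean ratio-4 square annulus; certifiable state by state for small `N, m`) and the
  DECORATION-REMOVAL step `stub_decorationRemoval : BoundaryTP2 → CriticalBubbleBound →
  CleanContraction → HeavinessContraction` — the only place where the route's hypotheses enter
  (mesh-scale re-pairing / bubble bound for the clustered tiny portals, BN1/BN3), and the G2 core;
* TOP STATE (`TopHeaviness`): in the FIXED Dobrushin domain the heaviness of a clean deep box has an
  exponential tail, constants depending on `(D, a, b)` (Disproof F2/F3: nothing uniform in `D`).

`stub_chain` is the bookkeeping (supermartingale `Y_l = 2^{μ h_l} ∏_{i<l} 1{h_i ≥ k'}`,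
`E[Y_{l+1} | F_l] ≤ ζ(k') Y_l` with `ζ(k') → 0`, plus the conversion "k separate traversals of
`D(x; ρ, R)` ⇒ `h_l ≥ ⌈k/2⌉` for the `≍ log₄(R/ρ)` dyadic boxes in between"): it yields (H1) on
INTERIOR shells (`closedBall x R ⊆ D`) with every exponent.  Boundary-centred shells are NOT reached
by clean boxes (card residue (a), triage (b)); they are the separate `stub_boundaryShells` (shared with
every clean-shape line).  The composition `traversalBound_of_shellBounds` — interior + exterior-centred
shell bounds with exponent 6 ⇒ (H1) with `λ = 3` by re-centring at the nearest point of `Dᶜ` and the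
square-root trick `min((ρ/d)^6, (d/R)^6) ≤ (ρ/R)^3` — is PROVED here (sorry-free), and
`TPToTraversalBound_of` concludes the crux BY NAME.

`sorry` occurs only in the five `stub_*` theorems.
-/

noncomputable section

open MeasureTheory Filter Topology Set Metric
open scoped NNReal ENNReal
open Literature.Probability.LatticeModels
open Literature.Probability.RandomPlanarGeometry
open Literature.Probability.RandomPlanarGeometry.SAW
open Summit.CriticalPhenomena.SAWScalingLimit.Theses.SAWTotalPositivity

namespace Summit.CriticalPhenomena.SAWScalingLimit.Cruxes.TPToTraversalBound.RadialPortalTransfer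

/-! ## Vocabulary of the line (lattice boxes, outside configuration, pieces, heaviness) -/

/-- Sup-norm distance on `ℤ²` (lattice units). -/
def supDist (p q : Site 2) : ℤ := max |p 0 - q 0| |p 1 - q 1|

/-- `v` lies in the OPEN lattice box of half-side `N` about `c`: `‖v - c‖_∞ < N`. -/
def InOpenBox (c : Site 2) (N : ℕ) (v : Site 2) : Prop := supDist v c < N

/-- The closed planar square of half-side `N δ` about the mesh point of `c` — the region required to
be CLEAN (contained in the domain), so that every lattice point of the closed box is a vertex of
`Ω_δ` with all its box edges. -/
def closedBox (δ : ℝ) (c : Site 2) (N : ℕ) : Set ℂ :=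
  {z | |z.re - (meshPoint δ c).re| ≤ N * δ ∧ |z.im - (meshPoint δ c).im| ≤ N * δ}

variable {Ω : Set ℂ} {δ : ℝ} {u v : Site 2}

/-- The OUTSIDE CONFIGURATION of a SAW relative to the box `(c, N)`: the set of its lattice edges
both of whose endpoints lie outside the open box.  Conditioning on it is the two-sided domain Markov
property of the weight `x_c^{|γ|}` (it factorises over edges); as `N` decreases these sets refine
each other (the outside configuration of a smaller box determines that of a larger one), so their
atoms generate a filtration over scales. -/
def outEdgeSet (γ : DomainSAW Ω δ u v) (c : Site 2) (N : ℕ) : Set (Sym2 (Site 2)) :=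
  {e | e ∈ γ.walk.edges ∧ ∀ w ∈ e, ¬ InOpenBox c N w}

/-- The index interval `[i, j]` of the walk is a MAXIMAL PIECE OUTSIDE the open box `(c, N)`
(a portal-to-portal excursion, or the initial / final strand): all its vertices lie outside the
open box and it cannot be extended on either side. Distinct maximal pieces are vertex-disjoint. -/
def IsOutsidePiece (γ : DomainSAW Ω δ u v) (c : Site 2) (N i j : ℕ) : Prop :=
  i ≤ j ∧ j ≤ γ.walk.length ∧ (∀ t, i ≤ t → t ≤ j → ¬ InOpenBox c N (γ.walk.getVert t)) ∧
    (i = 0 ∨ InOpenBox c N (γ.walk.getVert (i - 1))) ∧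
    (j = γ.walk.length ∨ InOpenBox c N (γ.walk.getVert (j + 1)))

/-- HEAVINESS COUNT: the walk has at least `m` distinct maximal pieces outside the open box `(c, N)`,
each of sup-diameter at least `d / 2` (lattice units).  With `d = N`: the BIG pieces (the state
variable `h_l ≥ m` of the radial chain); with `d = 0`: all pieces (so `¬ HasPieces γ c N 0 (m+1)`
says "at most `m` portal-to-portal excursions in total" = an undecorated `(m+1)`-strand state). -/
def HasPieces (γ : DomainSAW Ω δ u v) (c : Site 2) (N d m : ℕ) : Prop :=
  ∃ i j : Fin m → ℕ, StrictMono i ∧ ∀ k, IsOutsidePiece γ c N (i k) (j k) ∧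
    ∃ t t', i k ≤ t ∧ t ≤ j k ∧ i k ≤ t' ∧ t' ≤ j k ∧
      (d : ℤ) ≤ 2 * supDist (γ.walk.getVert t) (γ.walk.getVert t')

/-! ## Statements of the line -/

/-- **Clean kernel contraction** (the engine; undecorated states, triage r1-2).  There are `θ < 1`,
`λ₀ > 0`, `C`, `m₀` such that for every bounded `Ω`, mesh `δ > 0`, endpoints, lattice box
`B_∞(c, 4N)` whose closed planar square lies in `Ω`, and every outside configuration with AT MOST
`m` PIECES IN TOTAL (an undecorated `(m+1)`-strand boundary condition of the clean ratio-4 square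
annulus `B_∞(c,4N) ∖ B_∞(c,N)`), the conditional probability that the walk has `≥ j` big pieces
outside the four-times-smaller box `B_∞(c, N)` is `≤ C 2^{-λ₀ j}` whenever `j ≥ θ m + m₀`:
of `m` strands forced through the clean box at most a `θ`-fraction (plus `m₀`) reach the inner box,
and each further one costs a fixed factor.  Conditional probabilities are written on atoms:
`P(A ∩ {out = out γ₀}) ≤ q · P({out = out γ₀})`.  Small `N` are absorbed by `C` (`h ≤ 32N + 2`). -/
def CleanContraction : Prop :=
  ∃ (θ lam C : ℝ) (m₀ : ℕ), θ < 1 ∧ 0 < lam ∧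
    ∀ (Ω : Set ℂ) (δ : ℝ) (u v c : Site 2) (N m j : ℕ) (γ₀ : DomainSAW Ω δ u v),
      Bornology.IsBounded Ω → 0 < δ → 1 ≤ N → closedBox δ c (4 * N) ⊆ Ω →
      ¬ HasPieces γ₀ c (4 * N) 0 (m + 1) → θ * m + m₀ ≤ (j : ℝ) →
      law Ω δ u v {γ | outEdgeSet γ c (4 * N) = outEdgeSet γ₀ c (4 * N) ∧ HasPieces γ c N N j}
        ≤ ENNReal.ofReal (C * 2 ^ (-(lam * j))) *
          law Ω δ u v {γ | outEdgeSet γ c (4 * N) = outEdgeSet γ₀ c (4 * N)}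

/-- **Heaviness contraction** (uniform over decorated outside data — the G2 core, triage r1-2/3).
Same inequality, but the outside configuration `γ₀` is arbitrary except that it has at most `m` BIG
pieces (sup-diameter `≥ 2N`) outside `B_∞(c, 4N)`; any number of small pieces (clustered tiny
portals, BN3) is allowed and must not change `θ, λ₀, C, m₀`. -/
def HeavinessContraction : Prop :=
  ∃ (θ lam C : ℝ) (m₀ : ℕ), θ < 1 ∧ 0 < lam ∧
    ∀ (Ω : Set ℂ) (δ : ℝ) (u v c : Site 2) (N m j : ℕ) (γ₀ : DomainSAW Ω δ u v),
      Bornology.IsBounded Ω → 0 < δ → 1 ≤ N → closedBox δ c (4 * N) ⊆ Ω →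
      ¬ HasPieces γ₀ c (4 * N) (4 * N) (m + 1) → θ * m + m₀ ≤ (j : ℝ) →
      law Ω δ u v {γ | outEdgeSet γ c (4 * N) = outEdgeSet γ₀ c (4 * N) ∧ HasPieces γ c N N j}
        ≤ ENNReal.ofReal (C * 2 ^ (-(lam * j))) *
          law Ω δ u v {γ | outEdgeSet γ c (4 * N) = outEdgeSet γ₀ c (4 * N)}

/-- **Top state** (one clean scale in the FIXED domain).  For every Dobrushin domain and endpoint
approximation there are `C, c₁ > 0, δ₀ > 0` such that for every mesh `δ ≤ δ₀` and every lattice box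
`B_∞(c, N)`, `N ≥ 1`, sitting deep inside the domain (`closedBall (δc) (4Nδ) ⊆ D`), the chordal
critical SAW has `≥ m` big pieces outside the box (returns to the box after excursions of
sup-diameter `≥ Nδ/2`) with probability `≤ C e^{-c₁ m}`.  Constants depend on `(D, a, b)`
(Disproof F3: nothing uniform in the domain can be aimed at). -/
def TopHeaviness : Prop :=
  ∀ (D : DobrushinDomain) (a b : ℝ → Site 2), IsEndpointApprox D a b →
    ∃ (C c₁ δ₀ : ℝ), 0 < c₁ ∧ 0 < δ₀ ∧ ∀ δ ∈ Set.Ioc (0 : ℝ) δ₀, ∀ (c : Site 2) (N m : ℕ),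
      1 ≤ N → Metric.closedBall (meshPoint δ c) (4 * N * δ) ⊆ D.carrier →
        law D.carrier δ (a δ) (b δ) {γ | HasPieces γ c N N m}
          ≤ ENNReal.ofReal (C * Real.exp (-(c₁ * m)))

/-- **(H1) on interior shells, every exponent.**  For every `λ > 0`, Dobrushin domain and endpoint
approximation there are a shell-dependent threshold `k`, `K ≥ 0`, `δ₀ > 0` with
`P_δ(k(x,ρ,R) separate traversals of D(x; ρ, R)) ≤ K (ρ/R)^λ` for `δ ≤ δ₀`, `δ ≤ ρ < R ≤ 1` and
`closedBall x R ⊆ D` (the output of the radial chain: exponent `≍ k`). -/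
def InteriorShellBound : Prop :=
  ∀ lam : ℝ, 0 < lam → ∀ (D : DobrushinDomain) (a b : ℝ → Site 2), IsEndpointApprox D a b →
    ∃ (k : ℂ → ℝ → ℝ → ℕ) (K δ₀ : ℝ), 0 ≤ K ∧ 0 < δ₀ ∧ ∀ δ ∈ Set.Ioc (0 : ℝ) δ₀,
      ∀ (x : ℂ) (ρ R : ℝ), δ ≤ ρ → ρ < R → R ≤ 1 → Metric.closedBall x R ⊆ D.carrier →
        law D.carrier δ (a δ) (b δ)
            {γ | (⟨γ.walk.toCurve (meshPoint δ)⟩ : Curve ℂ).HasTraversals (k x ρ R) x ρ R}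
          ≤ ENNReal.ofReal (K * (ρ / R) ^ lam)

/-- **(H1) on shells centred outside the domain** (boundary shells; `x ∈ ∂D` is the case with
content, `x ∉ closure D` is trivial or reduces to it), every exponent, shell-dependent threshold
(it must absorb the forced crossings of `∂D` across the shell, Disproof F2(iii)/F3), constants
depending on `(D, a, b)`.  Not this line's mechanism: shared residue of the clean-shape lines. -/
def BoundaryShellBound : Prop :=
  ∀ lam : ℝ, 0 < lam → ∀ (D : DobrushinDomain) (a b : ℝ → Site 2), IsEndpointApprox D a b →
    ∃ (k : ℂ → ℝ → ℝ → ℕ) (K δ₀ : ℝ), 0 ≤ K ∧ 0 < δ₀ ∧ ∀ δ ∈ Set.Ioc (0 : ℝ) δ₀,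
      ∀ (x : ℂ) (ρ R : ℝ), x ∉ D.carrier → δ ≤ ρ → ρ < R → R ≤ 1 →
        law D.carrier δ (a δ) (b δ)
            {γ | (⟨γ.walk.toCurve (meshPoint δ)⟩ : Curve ℂ).HasTraversals (k x ρ R) x ρ R}
          ≤ ENNReal.ofReal (K * (ρ / R) ^ lam)

/-! ## Stubs (registered; `sorry` only here) -/

/-- STUB 1 (engine; open but clean and state-by-state certifiable for small `N, m`) — clean kernel
contraction for undecorated multi-strand states of the ratio-4 square annulus.  Its `m = 0, 1`
cases contain the ideator's `CleanDiveSquare` (KS Condition G1 for one clean shape, data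
0.93/0.91 at thirds) and the frame form of the critical strip gap (card `critical-strip-gap`). -/
theorem stub_cleanContraction : CleanContraction := by
  sorry

/-- STUB 2 (HARDEST; the G2 core, "decoration removal at bounded cost per scale", triage r1-2) —
from clean to arbitrarily decorated outside data.  The route's hypotheses enter HERE and only here:
TP₂ at mesh scale (re-pairing / shifting a junction by `O(1)` along the frame, reverse Simon–Lieb,
`TPToHarnack`) and the bubble bound (a tiny portal is a bounded local factor) are the junction
hygiene for the `≍ (N/δ)^{1/3}` clustered tiny portals (BN3); the threshold `θ m + m₀` is
`δ`-free, so no summed-junction (BN1) or tip-mass (BN2) bound may be used. -/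
theorem stub_decorationRemoval :
    BoundaryTP2 → CriticalBubbleBound → CleanContraction → HeavinessContraction := by
  sorry

/-- STUB 3 (open, one scale, fixed domain) — exponential tail of the heaviness of a clean deep box
under the chordal SAW law of the fixed Dobrushin domain (a `2m`-leg event off a clean frame;
`D`-dependent constants). -/
theorem stub_topHeaviness : TopHeaviness := by
  sorry

/-- STUB 4 (bookkeeping, XL but charted) — the radial chain: contraction + top state give (H1) on
interior shells with every exponent.  Ingredients: `F_l := σ(outEdgeSet · c N_l)` is a filtration
(`N_{l+1} = N_l / 4`), `h_l` is `F_l`-measurable, conditional expectations on the finite SAW space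
are atom sums; `Y_l := 2^{μ h_l} ∏_{i<l} 1{h_i ≥ k'}` satisfies `E[Y_{l+1} | F_l] ≤ ζ Y_l` with
`ζ = max(C' 2^{-λ₀ k'}, C'' 2^{-μ(1-θ)(k'-m₀)/θ})` (contraction on moderate atoms, forced decay on
super-heavy ones), `E[Y_0] < ∞` by the top state, hence `P(h_l ≥ k' ∀ l ≤ L) ≤ C ζ^L`;
conversion: `k` separate traversals of `D(x; ρ, R)` force `h_l ≥ ⌈k/2⌉` for every box
`B_∞(nearestSite δ x, N_l)`, `ρ + δ ≤ N_l δ ≤ R/8`, and there are `≥ log₄(R/ρ) - 3` of them. -/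
theorem stub_chain : HeavinessContraction → TopHeaviness → InteriorShellBound := by
  sorry

/-- STUB 5 (open; not this line's mechanism, shared by the clean-shape lines, triage finding (b)) —
(H1) for shells centred at points outside the open domain.  Handle: the boundary Jordan curve
traverses a genuine shell only finitely often (`Curve.exists_not_hasTraversals`), so beyond the
forced count the crossings are unforced crossings of finitely many boundary quads of `D`; the radial
chain runs in each quad with a dirty top state. -/
theorem stub_boundaryShells : BoundaryShellBound := by
  sorry

/-! ## Composition (sorry-free) -/

/-- Whatever the junk conventions, the SAW law gives mass at most `1` to every event. -/
theorem law_le_one (Ω : Set ℂ) (δ : ℝ) (u v : Site 2) (S : Set (DomainSAW Ω δ u v)) :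
    law Ω δ u v S ≤ 1 := by
  calc law Ω δ u v S ≤ law Ω δ u v Set.univ := measure_mono (Set.subset_univ _)
    _ = (weight Ω δ u v Set.univ)⁻¹ * weight Ω δ u v Set.univ := by
        rw [law, Measure.smul_apply, smul_eq_mul]
    _ ≤ 1 := ENNReal.inv_mul_le_one _

/-- Real powers with exponent `6`, `3` are the monomials. -/
theorem rpow_six (t : ℝ) : t ^ (6 : ℝ) = t ^ (6 : ℕ) := by
  rw [← Real.rpow_natCast]; norm_num

theorem rpow_three (t : ℝ) : t ^ (3 : ℝ) = t ^ (3 : ℕ) := by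
  rw [← Real.rpow_natCast]; norm_num

/-- **Shell reduction (proved).**  (H1) follows from the interior-shell and the exterior-centred-shell
bounds: for a shell `D(x; ρ, R)` with `R ≥ 16ρ` let `d = dist(x, Dᶜ)` and `y ∈ Dᶜ` a nearest point.
If `d² ≥ ρR` the shell `D(x; ρ, min(d/2, R))` is interior and `(2ρ/d)^6 ≤ (4ρ/R)^3`; if `d² < ρR`
the `k` traversals are traversals of `D(y; ρ + d, R - d)` and `((ρ+d)/(R-d))^6 ≤ (4ρ/R)^3`; if
`R < 16ρ` the bound `4096 (ρ/R)^3 ≥ 1` is free.  Exponent `6` in, `λ = 3 > 2` out. -/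
theorem traversalBound_of_shellBounds (hI : InteriorShellBound) (hB : BoundaryShellBound) :
    SAWTraversalBound := by
  intro D a b hab
  obtain ⟨kI, KI, δI, hKI, hδI, HI⟩ := hI 6 (by norm_num) D a b hab
  obtain ⟨kB, KB, δB, hKB, hδB, HB⟩ := hB 6 (by norm_num) D a b hab
  -- a nearest point of the complement of the domain
  have hne : (D.carrierᶜ).Nonempty := Set.nonempty_compl.2 D.toJordanDomain.carrier_ne_univ
  have hcl : IsClosed (D.carrierᶜ) := D.isOpen.isClosed_compl
  choose y hy hdy using fun x : ℂ => hcl.exists_infDist_eq_dist hne x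
  set d : ℂ → ℝ := fun x => Metric.infDist x D.carrierᶜ with hd
  refine ⟨fun x ρ R => max (kI x ρ (min (d x / 2) R)) (kB (y x) (ρ + d x) (R - d x)),
    64 * KI + 64 * KB + 4096, 3, min δI δB, by positivity, by norm_num, lt_min hδI hδB, ?_⟩
  intro δ hδ x ρ R hδρ hρR hR1
  have hδ0 : 0 < δ := hδ.1
  have hρ0 : 0 < ρ := hδ0.trans_le hδρ
  have hR0 : 0 < R := hρ0.trans hρR
  have hδI' : δ ∈ Set.Ioc (0 : ℝ) δI := ⟨hδ0, hδ.2.trans (min_le_left _ _)⟩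
  have hδB' : δ ∈ Set.Ioc (0 : ℝ) δB := ⟨hδ0, hδ.2.trans (min_le_right _ _)⟩
  set q : ℝ := ρ / R with hq
  have hq0 : 0 < q := div_pos hρ0 hR0
  have hq1 : q ≤ 1 := (div_le_one hR0).2 hρR.le
  have hd0 : 0 ≤ d x := Metric.infDist_nonneg
  rw [rpow_three]
  -- the event and its probability
  set P := law D.carrier δ (a δ) (b δ)
      {γ | (⟨γ.walk.toCurve (meshPoint δ)⟩ : Curve ℂ).HasTraversals
        (max (kI x ρ (min (d x / 2) R)) (kB (y x) (ρ + d x) (R - d x))) x ρ R} with hP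
  have hP1 : P ≤ 1 := law_le_one _ _ _ _ _
  by_cases h16 : R < 16 * ρ
  · -- trivial regime: the bound is at least 1
    have hq16 : 1 / 16 < q := by
      rw [hq, lt_div_iff₀ hR0]; linarith
    have hq3 : (1 / 16 : ℝ) ^ 3 < q ^ 3 := pow_lt_pow_left₀ hq16 (by norm_num) (by norm_num)
    have hbig : (1 : ℝ) ≤ (64 * KI + 64 * KB + 4096) * q ^ 3 := by nlinarith
    calc P ≤ 1 := hP1
      _ ≤ ENNReal.ofReal ((64 * KI + 64 * KB + 4096) * q ^ 3) := ENNReal.one_le_ofReal.2 hbig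
  push Not at h16
  by_cases hcase : ρ * R ≤ d x ^ 2
  · -- interior regime: the shell `D(x; ρ, min (d/2) R)` lies inside the domain
    have hd4 : 4 * ρ ≤ d x := by
      by_contra h
      push Not at h
      nlinarith
    have hdpos : 0 < d x := by linarith
    set R' : ℝ := min (d x / 2) R with hR'
    have hρR' : ρ < R' := lt_min (by linarith) hρR
    have hR'1 : R' ≤ 1 := (min_le_right _ _).trans hR1
    have hR'0 : 0 < R' := hρ0.trans hρR'
    have hball : Metric.closedBall x R' ⊆ D.carrier := by
      refine (Metric.closedBall_subset_ball ?_).trans Metric.ball_infDist_compl_subset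
      show R' < d x
      exact (min_le_left _ _).trans_lt (by linarith)
    have hmono : P ≤ law D.carrier δ (a δ) (b δ)
        {γ | (⟨γ.walk.toCurve (meshPoint δ)⟩ : Curve ℂ).HasTraversals (kI x ρ R') x ρ R'} := by
      refine measure_mono fun γ hγ => ?_
      exact (Curve.HasTraversals.of_le hγ (le_max_left _ _)).mono' le_rfl (min_le_right _ _)
    have hbound := HI δ hδI' x ρ R' hδρ hρR' hR'1 hball
    rw [rpow_six] at hbound
    -- `(ρ / R') ^ 6 ≤ 64 q ^ 3`
    have hkey : (ρ / R') ^ 2 ≤ 4 * q := by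
      rcases le_total (d x / 2) R with h | h
      · rw [hR', min_eq_left h]
        rw [div_pow, hq, div_le_iff₀ (by positivity)]
        rw [show 4 * (ρ / R) * (d x / 2) ^ 2 = ρ * d x ^ 2 / R by ring, le_div_iff₀ hR0]
        nlinarith
      · rw [hR', min_eq_right h, ← hq]
        nlinarith
    have h64 : (ρ / R') ^ 6 ≤ 64 * q ^ 3 := by
      calc (ρ / R') ^ 6 = ((ρ / R') ^ 2) ^ 3 := by ring
        _ ≤ (4 * q) ^ 3 := pow_le_pow_left₀ (sq_nonneg _) hkey 3
        _ = 64 * q ^ 3 := by ring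
    have hreal : KI * (ρ / R') ^ 6 ≤ (64 * KI + 64 * KB + 4096) * q ^ 3 := by
      have h1 : KI * (ρ / R') ^ 6 ≤ KI * (64 * q ^ 3) := mul_le_mul_of_nonneg_left h64 hKI
      nlinarith [pow_pos hq0 3]
    exact hmono.trans (hbound.trans (ENNReal.ofReal_le_ofReal hreal))
  · -- boundary regime: re-centre at the nearest point `y x ∈ Dᶜ`
    push Not at hcase
    have hdR : d x < R / 4 := by
      by_contra h
      push Not at h
      nlinarith
    have hyx : dist x (y x) = d x := (hdy x).symm
    set r' : ℝ := ρ + d x with hr'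
    set R'' : ℝ := R - d x with hR''
    have hδr' : δ ≤ r' := by linarith
    have hr'R'' : r' < R'' := by linarith
    have hR''1 : R'' ≤ 1 := by linarith
    have hR''0 : 0 < R'' := by linarith
    have hmono : P ≤ law D.carrier δ (a δ) (b δ)
        {γ | (⟨γ.walk.toCurve (meshPoint δ)⟩ : Curve ℂ).HasTraversals
          (kB (y x) r' R'') (y x) r' R''} := by
      refine measure_mono fun γ hγ => ?_
      refine (Curve.HasTraversals.of_le hγ (le_max_right _ _)).mono ?_ ?_
      · rw [hyx]
      · rw [hyx, hR'']; linarith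
    have hbound := HB δ hδB' (y x) r' R'' (hy x) hδr' hr'R'' hR''1
    rw [rpow_six] at hbound
    have hkey : (r' / R'') ^ 2 ≤ 4 * q := by
      rw [div_pow, hq, div_le_iff₀ (by positivity)]
      rw [show 4 * (ρ / R) * R'' ^ 2 = 4 * ρ * R'' ^ 2 / R by ring, le_div_iff₀ hR0]
      have h1 : d x ^ 2 * R ≤ ρ * R * R := by nlinarith
      have h2 : 2 * ρ * d x * R ≤ 2 * ρ * (R / 4) * R := by nlinarith
      have h3 : ρ ^ 2 * R ≤ ρ * (R / 16) * R := by nlinarith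
      have h4 : 4 * ρ * (3 * R / 4) ^ 2 ≤ 4 * ρ * R'' ^ 2 := by
        have : (3 * R / 4) ^ 2 ≤ R'' ^ 2 := pow_le_pow_left₀ (by positivity) (by linarith) 2
        nlinarith
      nlinarith
    have h64 : (r' / R'') ^ 6 ≤ 64 * q ^ 3 := by
      calc (r' / R'') ^ 6 = ((r' / R'') ^ 2) ^ 3 := by ring
        _ ≤ (4 * q) ^ 3 := pow_le_pow_left₀ (sq_nonneg _) hkey 3
        _ = 64 * q ^ 3 := by ring
    have hreal : KB * (r' / R'') ^ 6 ≤ (64 * KI + 64 * KB + 4096) * q ^ 3 := by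
      have h1 : KB * (r' / R'') ^ 6 ≤ KB * (64 * q ^ 3) := mul_le_mul_of_nonneg_left h64 hKB
      nlinarith [pow_pos hq0 3]
    exact hmono.trans (hbound.trans (ENNReal.ofReal_le_ofReal hreal))

/-- **`TPToTraversalBound` from the stubs.**  The crux is the implication TP₂ → B → (H1)
(`Iff.rfl`); TP₂ and the bubble bound are consumed by the decoration-removal stub, which together
with the clean contraction gives heaviness contraction; the chain turns it and the top state into
(H1) on interior shells; boundary shells are the fifth stub; the proved shell reduction assembles
(H1). -/
theorem TPToTraversalBound_of : TPToTraversalBound := fun hTP hBubble =>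
  traversalBound_of_shellBounds
    (stub_chain (stub_decorationRemoval hTP hBubble stub_cleanContraction) stub_topHeaviness)
    stub_boundaryShells

end Summit.CriticalPhenomena.SAWScalingLimit.Cruxes.TPToTraversalBound.RadialPortalTransfer

end
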